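import Summits.QuantumFields.YangMills.Theorems.BalabanUVNodesN10AtRecord12B13FamilyWitness

/-!
# BalabanUVNodes ∕ N10's LEVEL-T FAMILY JUNCTION AT STAGE 12 WITH THE RATE ROWS DISCHARGED — [Balaban1988RG2Cluster] Lemmas 1–3 member-wise at LEVEL T
# ((2.26) per term, NO Lemma-3 FLAG) from `…N10AtRecord12B13Family.b13FamLeafOfRecord₁₂_of_located_termwise`, its EIGHT (I.1.18)-rate ∕ κ₁ rows replaced by the
# re-pinned rate `2·10⁴ ≤ θ.s2.lf.κ` and the residual `κ₁ ≥ 16κ + 1` — the face a K1′∕K1″ assembler passes N10 through at a κ-re-pinned witness whose dictionary has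
# `8 ≤ L` (node00-def-K0a's `theta12OfFamilyL` ∕ `theta13OfFamily`: `eight_le_L_theta12OfFamilyL`, `kp_n10_theta12OfFamilyL`) (Track A, DAG node N10 [B13]; strategy s2;
# seat `pub-ymgap-dag-n10-d` g5; leaf module of `…N10AtRecord12B13FamilyWitness` p486907, whose §3 is the FLAG twin)

HONEST FRAMING.  Count-neutral kernel bookkeeping over LANDED modules: this seat's `…N10AtRecord12B13Family` (p480148∕p482076: the level-T family junction at the letters
of record and `thresholds_of_kappa_ge`) and `…N10AtRecord12B13FamilyWitness` (p486907: `kappa1_rows_of_ge`, the FLAG twin `b13FamLeafOfRecord₁₂_of_located_of_kappa_ge`,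
LOCATED-N10-ELL).  ONE theorem: the level-T junction with `hκ hδκ hκ126 hκ126' hR8 hR9 hκ₁ hκ₁'` DISCHARGED from `2·10⁴ ≤ θ.s2.lf.κ` and `16·θ.s2.lf.κ + 1 ≤ c.κ₁`; the
block-size binder `hL8 : 8 ≤ θ.ℓ₆ + 1` STAYS (it is FALSE at the ₁₂ witnesses over the dictionary of record, `…FamilyWitness` §2, and a THEOREM at node00-def-K0a's
witness with the family's block size, `Record12NumericsFamilyDict.eight_le_L_theta12OfFamilyL` — the consumer passes it), as do the located per-term inputs of Lemmas 1–2,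
(2.26) per term per member (NODE A's content in the termwise currency), ONE `Lemma3Numerics` bundle at the window-minimal rate, the fineness law and the residual rows.
Nothing of Bałaban's is asserted; N10 is NOT discharged; K0′ is NOT asserted; no node count moves; one finite four-torus programme at fixed ε per run; nothing
continuum ∕ ℝ⁴ ∕ OS ∕ mass-gap ∕ Clay.  0 `sorry`, 0 `def`, standard axioms.  Filed `--supports` K1′ «StabilityBAtRecordR12e» (stmt-QuantumFields-19903) of route «BalabanUVNodes»
(Stage-12-keyed; applies at a `Stage13Params` through `toStage12Params` by name).

WHAT THIS FILE PROVES.  `b13FamLeafOfRecord₁₂_of_located_termwise_of_kappa_ge`.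
-/

namespace Summit.QuantumFields.YangMills.BalabanUVNodes.N10AtRecord12B13FamilyRateDischarged

open Literature.MathematicalPhysics.QuantumFieldTheory.Balaban1983to89
open Literature.MathematicalPhysics.QuantumFieldTheory.Balaban1983to89.T4Continuum
open Literature.MathematicalPhysics.QuantumFieldTheory.Balaban1983to89.DagBinding
open Literature.MathematicalPhysics.QuantumFieldTheory.Balaban1983to89.Node00
open Literature.MathematicalPhysics.QuantumFieldTheory.Balaban1983to89.B13Lemma3Torus (TwoTorusStep)
open Literature.MathematicalPhysics.QuantumFieldTheory.Balaban1983to89.B13Lemma3TorusSocket (TermDomination Termwise226 Lemma3Numerics)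
open Literature.MathematicalPhysics.QuantumFieldTheory.Balaban1983to89.B12TreeDecay (kappa₀ K₀)
open Literature.MathematicalPhysics.QuantumFieldTheory.Balaban1983to89.B16Absorption (pbox)
open Literature.MathematicalPhysics.QuantumFieldTheory.Balaban1983to89.TreeLengthTorus
open Literature.MathematicalPhysics.QuantumFieldTheory.Balaban1983to89.TreeLengthTorusTransfer (tcoarse)
open Literature.MathematicalPhysics.QuantumFieldTheory.Balaban1983to89.B13PkScaling (scaled)
open Summit.QuantumFields.YangMills.BalabanUVNodes.N10AtRecord12B13Family (thresholds_of_kappa_ge b13FamLeafOfRecord₁₂_of_located_termwise)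
open Summit.QuantumFields.YangMills.BalabanUVNodes.N10AtRecord12B13FamilyWitness (kappa1_rows_of_ge)
open Metric
open scoped Matrix.Norms.L2Operator

section LevelT

variable (F : T4Family) (N : ℕ) [NeZero N]
variable (θ : Stage12Params F N) (c : B13.Consts) (lamF : ResidB13Fam₁₂ F N θ) (P : B12.RunParams)

set_option maxSynthPendingDepth 3 in
/-- **THE [B13] FAMILY LEAF OF RECORD AT A STAGE-12 RUN AT LEVEL T, WITH THE EIGHT RATE ∕ κ₁ ROWS OF LEMMA 1 DISCHARGED BY THE RE-PINNED RATE**: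
`…N10AtRecord12B13Family.b13FamLeafOfRecord₁₂_of_located_termwise` (Lemmas 1–2 member-wise from located inputs, Lemma 3 at LEVEL T from (2.26) per term per member at the
natural rate + ONE `Lemma3Numerics` bundle at the window-minimal rate `γ₂ε₁²∕γ²` + the fineness law + `8 ≤ L`) with its binders `hκ hδκ hκ126 hκ126' hR8 hR9 hκ₁ hκ₁'` REPLACED by
`2·10⁴ ≤ θ.s2.lf.κ` and `16·θ.s2.lf.κ + 1 ≤ c.κ₁` (`thresholds_of_kappa_ge`, `kappa1_rows_of_ge`); every other binder VERBATIM.  At node00-def-K0a's witness with the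
family's block size (`theta12OfFamilyL`, L = F.L ≥ 13, κ = 2·10⁴) `hκ` and `hL8` are THEOREMS (`kp_n10_theta12OfFamilyL`, `eight_le_L_theta12OfFamilyL`); at the ₁₂ witnesses
over the dictionary of record `hL8` is false (`…FamilyWitness` §2).  Count-neutral: hypotheses about the HIDDEN family; nothing of Bałaban's asserted.
[cite: Balaban1988RG2Cluster, Lemma 1 p.9, Lemma 2 p.11, Lemma 3 p.20, (2.26) p.17, p.18 (after (2.32)), (1.26) p.8, p.21 (after (2.41)); Balaban1987RG1, Thm 3 p.264, (1.18) p.263, p.251] -/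
theorem b13FamLeafOfRecord₁₂_of_located_termwise_of_kappa_ge
    (hc : ∀ k v, v ∈ FlowStep.Box θ.γ k → (lamF P k v).c = c13OfRecord₁₂ F N θ c) (hidx : ResidB13Fam.IsStepIndexed θ.γ (lamF P))
    (hN12 : ∀ k v, v ∈ FlowStep.Box θ.γ k → 12 ≤ (θ.ℓ₆ + 1) * ((lamF P k v).n + 1))
    -- (1) LEMMA 1: [I]'s block geometry of the (1.33) index families of every member in the box
    (dist : (k : ℕ) → (v : Fin (k + 1) → ℝ) → TDom 4 ((θ.ℓ₆ + 1) * ((lamF P k v).n + 1)) → TPt 4 ((θ.ℓ₆ + 1) * ((lamF P k v).n + 1)) → (j : ℕ) →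
      TPt 4 ((θ.ℓ₆ + 1) ^ ((lamF P k v).k - j) * ((θ.ℓ₆ + 1) * ((lamF P k v).n + 1))) → ℝ) {K K' : ℝ}
    (hS0Y : ∀ k v, v ∈ FlowStep.Box θ.γ k → ∀ Y, ∀ a ∈ (lamF P k v).S0 Y,
      (pbox (fun i => natLift a i - (5 : ℕ)) (fun i => natLift a i + 1 + (5 : ℕ))).image (proj ((θ.ℓ₆ + 1) * ((lamF P k v).n + 1))) ⊆ Y.1)
    (hFsub : ∀ k v, v ∈ FlowStep.Box θ.γ k → ∀ Y a, (lamF P k v).F Y a ⊆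
      (pbox (fun i => natLift a i - (5 : ℕ)) (fun i => natLift a i + 1 + (5 : ℕ))).image (proj ((θ.ℓ₆ + 1) * ((lamF P k v).n + 1))) \
        (pbox (fun i => natLift a i - (4 : ℕ)) (fun i => natLift a i + 1 + (4 : ℕ))).image (proj ((θ.ℓ₆ + 1) * ((lamF P k v).n + 1))))
    (hSq : ∀ k v, v ∈ FlowStep.Box θ.γ k → ∀ Y, ∀ a ∈ (lamF P k v).S0 Y, ∀ j, (lamF P k v).Sq Y a j ⊆
      (Finset.univ : Finset (TPt 4 ((θ.ℓ₆ + 1) ^ ((lamF P k v).k - j) * ((θ.ℓ₆ + 1) * ((lamF P k v).n + 1))))).filter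
        (fun q => tcoarse ((θ.ℓ₆ + 1) ^ ((lamF P k v).k - j)) ((θ.ℓ₆ + 1) * ((lamF P k v).n + 1)) q ∈
          (pbox (fun i => natLift a i - (2 : ℕ)) (fun i => natLift a i + 1 + (2 : ℕ))).image (proj ((θ.ℓ₆ + 1) * ((lamF P k v).n + 1)))))
    (hScY : ∀ k v, v ∈ FlowStep.Box θ.γ k → ∀ Y, (lamF P k v).Sc Y ⊆ Y.1)
    (hdist0 : ∀ k v, v ∈ FlowStep.Box θ.γ k → ∀ Y a j q, 0 ≤ c.δ₀ * dist k v Y a j q)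
    (hdist : ∀ k v, v ∈ FlowStep.Box θ.γ k → ∀ Y a j (n : ℕ) q,
      q ∉ (pbox (fun i => (((θ.ℓ₆ + 1) ^ ((lamF P k v).k - j) : ℕ) : ℤ) * natLift a i - (n + 1 : ℕ))
        (fun i => (((θ.ℓ₆ + 1) ^ ((lamF P k v).k - j) : ℕ) : ℤ) * natLift a i + 2 * (((θ.ℓ₆ + 1) ^ ((lamF P k v).k - j) : ℕ) : ℤ) - 1 + (n + 1 : ℕ))).image
          (proj ((θ.ℓ₆ + 1) ^ ((lamF P k v).k - j) * ((θ.ℓ₆ + 1) * ((lamF P k v).n + 1)))) →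
        c.δ₀ * c.M * ((n : ℝ) + 1) ≤ c.δ₀ * dist k v Y a j q)
    (hSX : ∀ k v, v ∈ FlowStep.Box θ.γ k → ∀ Y a j q,
      (lamF P k v).SX Y a j q ⊆ (tcubeSys 4 ((θ.ℓ₆ + 1) ^ ((lamF P k v).k - j) * ((θ.ℓ₆ + 1) * ((lamF P k v).n + 1)))).above q)
    (hSX' : ∀ k v, v ∈ FlowStep.Box θ.γ k → ∀ Y a j q,
      (lamF P k v).SX' Y a j q ⊆ (tcubeSys 4 ((θ.ℓ₆ + 1) ^ ((lamF P k v).k - j) * ((θ.ℓ₆ + 1) * ((lamF P k v).n + 1)))).above q)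
    (hX0 : ∀ k v, v ∈ FlowStep.Box θ.γ k → ∀ Y, ∀ a ∈ (lamF P k v).Sc Y, ∀ j ∈ Finset.range ((lamF P k v).k + 1), ∀ q ∈ (lamF P k v).Sq' Y a j,
      ∀ x ∈ (lamF P k v).SX' Y a j q, x.1.image (tcoarse ((θ.ℓ₆ + 1) ^ ((lamF P k v).k - j)) ((θ.ℓ₆ + 1) * ((lamF P k v).n + 1))) ⊆ Y.1)
    -- (1) LEMMA 1: per-term analyticity on (1.34), every member in the box
    (hAnT : ∀ k v, v ∈ FlowStep.Box θ.γ k → ∀ Y, ∀ a ∈ (lamF P k v).S0 Y, ∀ X ∈ ((lamF P k v).F Y a).powerset, ∀ j ∈ Finset.range ((lamF P k v).k + 1),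
      ∀ q ∈ (lamF P k v).Sq Y a j, ∀ x ∈ (lamF P k v).SX Y a j q, AnalyticOnNhd ℂ ((lamF P k v).T Y a X j q x) ((lamF P k v).sp1 Y))
    (hAnT' : ∀ k v, v ∈ FlowStep.Box θ.γ k → ∀ Y, ∀ a ∈ (lamF P k v).Sc Y, ∀ j ∈ Finset.range ((lamF P k v).k + 1), ∀ q ∈ (lamF P k v).Sq' Y a j,
      ∀ x ∈ (lamF P k v).SX' Y a j q, AnalyticOnNhd ℂ ((lamF P k v).T' Y a j q x) ((lamF P k v).sp1 Y))
    -- (1) LEMMA 1: the k-UNIFORM thresholds READ IN θ's OWN LETTERS (κ, δ of record) and the residual letters (κ₁, δ₀, M); `δ < 1` DISCHARGED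
    (hK : 0 ≤ K) (hK' : 0 ≤ K') (hκ : 2 * 10 ^ 4 ≤ θ.s2.lf.κ) (hκ₁ : 16 * θ.s2.lf.κ + 1 ≤ c.κ₁)
    (hδ₀M : 10 * Real.exp (-1) ≤ c.δ₀ * c.M) (hδ₀M5 : 2 * Real.log 5 ≤ c.δ₀ * c.M)
    -- (1) LEMMA 1: per-term (1.24), (1.30) by reference to [I] (3.54), (3.17), [15] Prop. 4, [13] (3.108), every member in the box; k-UNIFORM `K, K′`; the choice `hC` reads θ's `E₀`
    (h124 : ∀ k v, v ∈ FlowStep.Box θ.γ k → ∀ Y φ, φ ∈ (lamF P k v).sp1 Y → ∀ a ∈ (lamF P k v).S0 Y, ∀ X ∈ ((lamF P k v).F Y a).powerset,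
      ∀ j ∈ Finset.range ((lamF P k v).k + 1), ∀ q ∈ (lamF P k v).Sq Y a j, ∀ x ∈ (lamF P k v).SX Y a j q,
        ‖(lamF P k v).T Y a X j q x φ‖ ≤ K * (((θ.ℓ₆ + 1 : ℕ) : ℝ) ^ j * (((θ.ℓ₆ + 1 : ℕ) : ℝ) ^ (lamF P k v).k)⁻¹) ^ 5 *
          Real.exp (-(c.κ₁ - 1) *
            (((Y.1 \ (pbox (fun i => natLift a i - (5 : ℕ)) (fun i => natLift a i + 1 + (5 : ℕ))).image
              (proj ((θ.ℓ₆ + 1) * ((lamF P k v).n + 1)))).card : ℝ) + X.card)) *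
          Real.exp (-(θ.s2.lf.κ * torusTreeLen x.1)))
    (h130 : ∀ k v, v ∈ FlowStep.Box θ.γ k → ∀ Y φ, φ ∈ (lamF P k v).sp1 Y → ∀ a ∈ (lamF P k v).Sc Y, ∀ j ∈ Finset.range ((lamF P k v).k + 1),
      ∀ q ∈ (lamF P k v).Sq' Y a j, ∀ x ∈ (lamF P k v).SX' Y a j q,
        ‖(lamF P k v).T' Y a j q x φ‖ ≤ K' * Real.exp (-(1 / 2) * (c.δ₀ * c.M) * (((θ.ℓ₆ + 1 : ℕ) : ℝ) ^ j * (((θ.ℓ₆ + 1 : ℕ) : ℝ) ^ (lamF P k v).k)⁻¹)⁻¹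
            - (1 / 2) * c.δ₀ * dist k v Y a j q) *
          Real.exp (-(c.κ₁ - 1) * ((Y.1 \ x.1.image (tcoarse ((θ.ℓ₆ + 1) ^ ((lamF P k v).k - j)) ((θ.ℓ₆ + 1) * ((lamF P k v).n + 1)))).card : ℝ)) *
          Real.exp (-(θ.s2.lf.κ * torusTreeLen x.1)))
    {ϑ : ℝ} (hϑ0 : 0 ≤ ϑ) (hϑ1 : ϑ < 1)
    (hC : K * K₀ 64 8 * (2 * (6 * ((θ.ℓ₆ + 1 : ℕ) : ℝ)) ^ 4) * Real.exp 1 * Real.exp ((1 / 8) * c.κ₁ * (12 ^ 4 - 1)) +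
        2 * (64 * K') * K₀ 64 8 * 1344 ≤
      (1 - ϑ) * (θ.s2.lf.E₀ * c.ε₁ * c.C₁ * c.M ^ c.q * Real.exp (c.C₂ * c.κ₁)))
    -- (2) LEMMA 2 (pp. 10–11): the curvature terms and the plaquette data of every member in the box; k-UNIFORM `ϑ, R, K₂, m₂`; `g_k ≠ 0` DISCHARGED (index law)
    (hGlAn : ∀ k v, v ∈ FlowStep.Box θ.γ k → ∀ Y, AnalyticOnNhd ℂ ((lamF P k v).Gl Y) ((lamF P k v).sp1 Y))
    (hGl : ∀ k v, v ∈ FlowStep.Box θ.γ k → ∀ Y φ, φ ∈ (lamF P k v).sp1 Y →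
      ‖(lamF P k v).Gl Y φ‖ ≤ ϑ * (θ.s2.lf.E₀ * c.ε₁ * c.C₁ * c.M ^ c.q * Real.exp (c.C₂ * c.κ₁)) *
        Real.exp (-((1 - 2 * (c13OfRecord₁₂ F N θ c).δ) * θ.s2.lf.κ * (tsys 4 ((θ.ℓ₆ + 1) * ((lamF P k v).n + 1))).dj Y)))
    (he : ∀ k v, v ∈ FlowStep.Box θ.γ k → ∀ Y b, ‖(lamF P k v).e Y b‖ ≤ 1)
    {R K₂ : ℝ} {m₂ : ℕ} (hK₂ : 0 ≤ K₂) (hR : 0 < R) (hε3 : 3 * c.ε₁ ≤ R)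
    (hW : ∀ k v, v ∈ FlowStep.Box θ.γ k → ∀ Y, ∀ i ∈ (lamF P k v).s Y, ∀ φ ∈ (lamF P k v).sp1 Y, AnalyticOnNhd ℂ ((lamF P k v).Wf Y i φ) (ball 0 R))
    (hKW : ∀ k v, v ∈ FlowStep.Box θ.γ k → ∀ Y, ∀ i ∈ (lamF P k v).s Y, ∀ φ ∈ (lamF P k v).sp1 Y, ∀ z ∈ ball (0 : (lamF P k v).E) R,
      ‖(lamF P k v).Wf Y i φ z‖ ≤ K₂ * Real.exp (-(c.κ₁ - 1) * ((Y.1.card : ℝ) - 1)) * ‖z‖ ^ 3)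
    (hcard : ∀ k v, v ∈ FlowStep.Box θ.γ k → ∀ Y, ((lamF P k v).s Y).card ≤ m₂ * Y.1.card)
    (hsp : ∀ k v, v ∈ FlowStep.Box θ.γ k → ∀ Y φ, φ ∈ (lamF P k v).sp1 Y → ‖(lamF P k v).g‖ * ‖(lamF P k v).rd Y φ‖ < c.ε₁)
    (hfloor : 27 * m₂ * K₂ * Real.exp (c.κ₁ - 1) ≤ c.C₃ * c.M ^ 4 * Real.exp (c.C₂ * c.κ₁))
    (hAnP : ∀ k v, v ∈ FlowStep.Box θ.γ k → ∀ Y, ∀ i ∈ (lamF P k v).s Y,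
      AnalyticOnNhd ℂ (fun φ => scaled (lamF P k v).g ((lamF P k v).Wf Y i φ) ((lamF P k v).rd Y φ)) ((lamF P k v).sp1 Y))
    (hG : ∀ k v, v ∈ FlowStep.Box θ.γ k → ∀ Y, (lamF P k v).GaugeInv ((lamF P k v).V Y) ∧
      (lamF P k v).GaugeInv ((WtOfRecord θ.toStage3Params (lamF P k v)).toStepData.quadForm Y) ∧ (lamF P k v).GaugeInv ((lamF P k v).Vpp Y))
    -- (3) LEMMA 3 (pp. 14–20) at LEVEL T: (2.26) per term per member at the natural rate; ONE numerics bundle at the window-minimal rate (p. 18); the fineness law; 8 ≤ L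
    (hL8 : 8 ≤ θ.ℓ₆ + 1) (hγ₂ : 0 ≤ c.γ₂) {m₃ : ℕ} (hm₃ : ∀ k v, v ∈ FlowStep.Box θ.γ k → (lamF P k v).m₃ = m₃) {a₂ a₂' a₅ Aabs : ℝ}
    (h226 : ∀ k v, v ∈ FlowStep.Box θ.γ k →
      Termwise226 (c13OfRecord₁₂ F N θ c) (c.γ₂ * c.ε₁ ^ 2 / (v (Fin.last k)) ^ 2) a₅ (WtOfRecord θ.toStage3Params (lamF P k v)) (lamF P k v).T₃)
    (hN : Lemma3Numerics (c13OfRecord₁₂ F N θ c) (m₃ + 1) (((θ.ℓ₆ + 1 : ℕ) : ℝ) / 2) (c.γ₂ * c.ε₁ ^ 2 / θ.γ ^ 2) a₂ a₂' a₅ Aabs) :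
    B13FamLeafOfRecord₁₂ F N θ c lamF P := by
  obtain ⟨hκ0, hδκ, hκ126, hκ126', hR8, hR9⟩ := thresholds_of_kappa_ge F N θ c hκ hκ₁
  obtain ⟨hκ₁a, hκ₁b⟩ := kappa1_rows_of_ge (κ₁ := c.κ₁) (by linarith)
  exact b13FamLeafOfRecord₁₂_of_located_termwise F N θ c lamF P hc hidx hN12 dist hS0Y hFsub hSq hScY hdist0 hdist hSX hSX' hX0 hAnT hAnT' hK hK'
    hκ0 hδκ hκ126 hκ126' hκ₁a hκ₁b hδ₀M hδ₀M5 hR8 hR9 h124 h130 hϑ0 hϑ1 hC hGlAn hGl he hK₂ hR hε3 hW hKW hcard hsp hfloor hAnP hG hL8 hγ₂ hm₃ h226 hN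

end LevelT

end Summit.QuantumFields.YangMills.BalabanUVNodes.N10AtRecord12B13FamilyRateDischarged
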